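import Summits.CriticalPhenomena.PercolationContinuityZ3.Theorems.PercNearOneGluingNoHeavyLowerTailSunflowerPromotion
import Summits.CriticalPhenomena.PercolationContinuityZ3.Theorems.PercNearOneGluingNoHeavyLowerTailSunflowerPartitionReduction
import HarnessLib
import HarnessLib.Audit

/-!
# `NoHeavyLowerTail` (crux stmt-CriticalPhenomena-4575), abstract sunflower cubic: RESTRICTION MONOTONICITY (MZ) at a coordinate
# whose singleton is not a bottom set — the first proved cases of `RestrictionMonotonicity`

Support file (seat `prim-l12-p2` gen 7; `--supports stmt-CriticalPhenomena-4575`; companion of `…SunflowerAntipodalGladkov` (p214186),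
`…SunflowerPartitionLemma`, `…SunflowerPromotion`, `…SunflowerPartitionReduction`).  Memo:
run/shared/lean/prim/prim-l12/prim-l12-p2/FINDING-g7-MZ-STRUCTURE.md.  Nothing is asserted about the crux; no `sorry`.

SETTING.  `F : Sunflower α` (monotone `lab : 2^α → M₃`), a sub-cube `2^W`, and the partition functional on it in NESTED form
`ZW F W = Σ_{X ⊆ W} Σ_{S ⊆ W∖X} s6H (lab X) (lab S) (lab ((W∖X)∖S))` (`= F.ZP W ∅ ∅ ∅` of `…SunflowerPartitionReduction`, `ZW_eq_ZP`).
The conjecture `RestrictionMonotonicity` (MZ) says `ZW F W ≤ ZW F (insert e W)` for `e ∉ W`.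

MAIN RESULTS (this work).
* `ZW_insert_eq` — one-coordinate expansion: `ZW F (insert e W) = 3 · Σ_{X ⊆ W} Σ_{S ⊆ W∖X} s6H (lab (insert e X)) (lab S) (lab ((W∖X)∖S))`
  (the three placements of `e` contribute equally, by the block symmetries `nested_swap12`, `nested_swap23` of the nested sum).
* `three_joinLift_ge` — the PRINCIPAL-LIFT INEQUALITY: for every `v ≠ 0` in `M₃`,
  `Σ_X Σ_S s6H (lab X) … ≤ 3 · Σ_X Σ_S s6H (v ∨ lab X) …`  — i.e. (MZ) for the lift `X ↦ v ∨ lab X`; it is the sum of three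
  spectator instances of antipodal Gladkov (`spectator_gladkov_nonneg`) and a kernel that is pointwise nonnegative after symmetrisation
  over the six block orders (`symm6_liftKernel_nonneg`, `decide`), cf. memo (ID0): `3ℓ(k∨φ) − Z(φ) = 6(slack_⊤+slack_i+slack_j) + 6N(⊤,i,j)`.
* `ZW_le_ZW_insert_of_lab_singleton_ne_zero` — **(MZ) holds at every coordinate `e` with `lab {e} ≠ 0`**: `ZW F W ≤ ZW F (insert e W)`.
  Proof: `lab (insert e X) ∈ {v ∨ lab X, ⊤}` with `v = lab {e}` (`lab_insert_cases`); where it is `⊤` instead of a petal the inner sum only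
  grows (`Sunflower.promotion_sum_nonneg`, p217422); then `three_joinLift_ge`.  In `RestrictionMonotonicity` format: `ZP_le_ZP_insert_of_lab_singleton_ne_zero`.
* `ZW_nonneg_of_forall_lab_singleton_ne_zero` — corollary: the partition lemma `0 ≤ ZW F W` on every sub-cube all of whose singletons
  are petal or kernel sets (e.g. the `θ(Hit₁,Hit₂,Hit₃)` stars); and the reduction `partitionLemmaH` ⟸ same for sunflowers whose singletons are all bottom
  is the contrapositive reading (memo §2).
-/

namespace Summit.CriticalPhenomena.PercolationContinuityZ3.Theorems.SunflowerPartition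

open Finset

/-! ## The `M₃` join with a fixed value, and kernels -/

/-- Join in `M₃` (coded on `Fin 5`: `0` bottom, `1,2,3` petals, `4` top). [this work] -/
def joinM (v x : Fin 5) : Fin 5 :=
  if x = 0 then v else if v = 0 then x else if x = v then x else 4

/-- Symmetrisation of a kernel over the six block orders. [this work] -/
def symm6 (g : Fin 5 → Fin 5 → Fin 5 → ℤ) (x y z : Fin 5) : ℤ :=
  g x y z + g x z y + g y x z + g y z x + g z x y + g z y x

/-- Spectator weights of the principal-lift certificate: for a petal `v`, weight `3` on the spectator labels `⊤` and the two petals `≠ v`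
(the three antipodal-Gladkov inequalities `G_⊤ + G_i + G_j` of the memo); for `v = ⊤`, weight `3` on the three petals. [this work] -/
def liftWeight (v x : Fin 5) : ℤ :=
  if v = 4 then (if x ≠ 0 ∧ x ≠ 4 then 3 else 0)
  else (if x = 4 ∨ (x ≠ 0 ∧ x ≠ v) then 3 else 0)

/-- The principal-lift kernel minus its Gladkov part: `3·s6H (v∨x) y z − s6H x y z − a(v,x)·kk y z`. [this work] -/
def liftKernel (v : Fin 5) (x y z : Fin 5) : ℤ :=
  3 * s6H (joinM v x) y z - s6H x y z - liftWeight v x * kk y z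

/-- After symmetrisation over the six block orders the lift kernel is pointwise nonnegative (for `v ≠ 0`). [this work] -/
theorem symm6_liftKernel_nonneg : ∀ v x y z : Fin 5, v ≠ 0 → 0 ≤ symm6 (liftKernel v) x y z := by decide

/-- The spectator weights are nonnegative. [this work] -/
theorem liftWeight_nonneg : ∀ v x : Fin 5, 0 ≤ liftWeight v x := by decide

variable {α : Type*} [DecidableEq α]

/-! ## Nested partition sums on a sub-cube and their block symmetries -/

/-- Nested sum over ordered 3-partitions `(X, S, (W∖X)∖S)` of `W` of a function of the three blocks. [this work] -/
def nested (W : Finset α) (G : Finset α → Finset α → Finset α → ℤ) : ℤ :=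
  ∑ X ∈ W.powerset, ∑ S ∈ (W \ X).powerset, G X S ((W \ X) \ S)

/-- Swapping the second and third blocks. [this work] -/
theorem nested_swap23 (W : Finset α) (G : Finset α → Finset α → Finset α → ℤ) :
    nested W G = nested W (fun X S T => G X T S) := by
  unfold nested
  refine sum_congr rfl fun X _ => ?_
  refine sum_nbij' (fun S => (W \ X) \ S) (fun S => (W \ X) \ S) ?_ ?_ ?_ ?_ ?_
  · intro S _; exact mem_powerset.2 sdiff_subset
  · intro S _; exact mem_powerset.2 sdiff_subset
  · intro S hS; exact Finset.sdiff_sdiff_eq_self (mem_powerset.1 hS)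
  · intro S hS; exact Finset.sdiff_sdiff_eq_self (mem_powerset.1 hS)
  · intro S hS; rw [Finset.sdiff_sdiff_eq_self (mem_powerset.1 hS)]

/-- The nested sum as a sum over disjoint pairs of subsets of `W`. [this work] -/
theorem nested_eq_sum_filter (W : Finset α) (G : Finset α → Finset α → Finset α → ℤ) :
    nested W G = ∑ q ∈ (W.powerset ×ˢ W.powerset).filter (fun q => Disjoint q.1 q.2), G q.1 q.2 (W \ (q.1 ∪ q.2)) := by
  unfold nested
  rw [sum_filter, sum_product]
  refine sum_congr rfl fun X _ => ?_
  rw [← sum_filter]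
  have hf : (W.powerset.filter fun T => Disjoint X T) = (W \ X).powerset := by
    ext T
    simp only [mem_filter, mem_powerset, subset_sdiff]
    constructor
    · rintro ⟨h1, h2⟩; exact ⟨h1, h2.symm⟩
    · rintro ⟨h1, h2⟩; exact ⟨h1, h2.symm⟩
  rw [hf]
  refine sum_congr rfl fun S _ => ?_
  rw [sdiff_sdiff_left, sup_eq_union]

/-- Swapping the first and second blocks. [this work] -/
theorem nested_swap12 (W : Finset α) (G : Finset α → Finset α → Finset α → ℤ) :
    nested W G = nested W (fun X S T => G S X T) := by
  rw [nested_eq_sum_filter, nested_eq_sum_filter]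
  refine sum_nbij' (fun q => (q.2, q.1)) (fun q => (q.2, q.1)) ?_ ?_ ?_ ?_ ?_
  · intro q hq
    simp only [mem_filter, mem_product] at hq ⊢
    exact ⟨⟨hq.1.2, hq.1.1⟩, hq.2.symm⟩
  · intro q hq
    simp only [mem_filter, mem_product] at hq ⊢
    exact ⟨⟨hq.1.2, hq.1.1⟩, hq.2.symm⟩
  · intro q _; rfl
  · intro q _; rfl
  · intro q _; simp only [union_comm]

/-- Full symmetrisation: six times a nested kernel sum equals the nested sum of the symmetrised kernel. [this work] -/
theorem six_mul_nested_eq_symm6 (W : Finset α) (L : Finset α → Fin 5) (g : Fin 5 → Fin 5 → Fin 5 → ℤ) :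
    6 * nested W (fun X S T => g (L X) (L S) (L T)) = nested W (fun X S T => symm6 g (L X) (L S) (L T)) := by
  have e1 : nested W (fun X S T => g (L X) (L S) (L T)) = nested W (fun X S T => g (L X) (L T) (L S)) :=
    nested_swap23 W (fun X S T => g (L X) (L S) (L T))
  have e2 : nested W (fun X S T => g (L X) (L S) (L T)) = nested W (fun X S T => g (L S) (L X) (L T)) :=
    nested_swap12 W (fun X S T => g (L X) (L S) (L T))
  have e3 : nested W (fun X S T => g (L X) (L S) (L T)) = nested W (fun X S T => g (L S) (L T) (L X)) :=
    e1.trans (nested_swap12 W (fun X S T => g (L X) (L T) (L S)))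
  have e4 : nested W (fun X S T => g (L X) (L S) (L T)) = nested W (fun X S T => g (L T) (L X) (L S)) :=
    e2.trans (nested_swap23 W (fun X S T => g (L S) (L X) (L T)))
  have e5 : nested W (fun X S T => g (L X) (L S) (L T)) = nested W (fun X S T => g (L T) (L S) (L X)) :=
    e3.trans (nested_swap23 W (fun X S T => g (L S) (L T) (L X)))
  have key : nested W (fun X S T => symm6 g (L X) (L S) (L T))
      = nested W (fun X S T => g (L X) (L S) (L T)) + nested W (fun X S T => g (L X) (L T) (L S))
        + nested W (fun X S T => g (L S) (L X) (L T)) + nested W (fun X S T => g (L S) (L T) (L X))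
        + nested W (fun X S T => g (L T) (L X) (L S)) + nested W (fun X S T => g (L T) (L S) (L X)) := by
    unfold nested symm6
    simp only [sum_add_distrib]
  rw [key, ← e1, ← e2, ← e3, ← e4, ← e5]
  ring

/-! ## Spectator Gladkov on a sub-cube -/

/-- **Spectator Gladkov**: for nonnegative spectator weights `a`, `0 ≤ Σ_X a(lab X) · Σ_{S ⊆ W∖X} kk (lab S) (lab ((W∖X)∖S))`
(antipodal Gladkov on every complement cube). [this work] -/
theorem Sunflower.spectator_gladkov_nonneg (F : Sunflower α) (W : Finset α) (a : Fin 5 → ℤ) (ha : ∀ x, 0 ≤ a x) :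
    0 ≤ nested W (fun X S T => a (F.lab X) * kk (F.lab S) (F.lab T)) := by
  unfold nested
  refine sum_nonneg fun X _ => ?_
  rw [← mul_sum]
  exact mul_nonneg (ha _) (F.antipodal_gladkov (W \ X))

/-! ## The principal-lift inequality (MZ for `X ↦ v ∨ lab X`) -/

/-- **Principal-lift inequality** (this work, memo (ID0)): for every `v ≠ 0`,
`Σ_X Σ_S s6H (lab X) (lab S) (lab T) ≤ 3 · Σ_X Σ_S s6H (v ∨ lab X) (lab S) (lab T)` on every sub-cube `W`.  It is the sum of the
spectator-Gladkov inequalities with weights `liftWeight v` and of a kernel nonnegative after symmetrisation over block orders. -/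
theorem Sunflower.three_joinLift_ge (F : Sunflower α) (W : Finset α) (v : Fin 5) (hv : v ≠ 0) :
    nested W (fun X S T => s6H (F.lab X) (F.lab S) (F.lab T))
      ≤ 3 * nested W (fun X S T => s6H (joinM v (F.lab X)) (F.lab S) (F.lab T)) := by
  have hsym := six_mul_nested_eq_symm6 W F.lab (liftKernel v)
  have hpos : 0 ≤ nested W (fun X S T => symm6 (liftKernel v) (F.lab X) (F.lab S) (F.lab T)) := by
    unfold nested
    exact sum_nonneg fun X _ => sum_nonneg fun S _ => symm6_liftKernel_nonneg v _ _ _ hv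
  have hglad := F.spectator_gladkov_nonneg W (liftWeight v) (liftWeight_nonneg v)
  have hdec : nested W (fun X S T => liftKernel v (F.lab X) (F.lab S) (F.lab T))
      = 3 * nested W (fun X S T => s6H (joinM v (F.lab X)) (F.lab S) (F.lab T))
        - nested W (fun X S T => s6H (F.lab X) (F.lab S) (F.lab T))
        - nested W (fun X S T => liftWeight v (F.lab X) * kk (F.lab S) (F.lab T)) := by
    unfold nested liftKernel
    simp only [sum_sub_distrib, mul_sum]
  have h6 : 0 ≤ 6 * nested W (fun X S T => liftKernel v (F.lab X) (F.lab S) (F.lab T)) := by rw [hsym]; exact hpos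
  linarith

/-! ## One-coordinate expansion of the nested partition sum -/

/-- Value-level case analysis behind `lab_insert_cases`. [this work] -/
theorem joinM_cases : ∀ a b c : Fin 5, a ≠ 0 → (a = c ∨ a = 0 ∨ c = 4) → (b = c ∨ b = 0 ∨ c = 4) →
    c = joinM a b ∨ (c = 4 ∧ (joinM a b = 1 ∨ joinM a b = 2 ∨ joinM a b = 3)) := by decide

/-- `lab (insert e X)` is either the join `lab {e} ∨ lab X` or the top, and in the latter case the join is a petal
(unless it is already the top). [this work] -/
theorem Sunflower.lab_insert_cases (F : Sunflower α) (e : α) (X : Finset α) (hv : F.lab {e} ≠ 0) :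
    F.lab (insert e X) = joinM (F.lab {e}) (F.lab X)
      ∨ (F.lab (insert e X) = 4 ∧ (joinM (F.lab {e}) (F.lab X) = 1 ∨ joinM (F.lab {e}) (F.lab X) = 2
          ∨ joinM (F.lab {e}) (F.lab X) = 3)) := by
  have h1 := F.lab_mono (show ({e} : Finset α) ⊆ insert e X from singleton_subset_iff.2 (mem_insert_self e X))
  have h2 := F.lab_mono (subset_insert e X)
  exact joinM_cases _ _ _ hv h1 h2

/-- Cyclic symmetry of `s6H`. [this work] -/
theorem s6H_cycle : ∀ a b c : Fin 5, s6H a b c = s6H c a b := by decide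

/-- **One-coordinate expansion**: for `e ∉ W`, the partition sum on `insert e W` is three times the nested sum on `W` with the FIRST
block lifted by `e` (the three placements of `e` contribute equally by block symmetry). [this work] -/
theorem Sunflower.nested_insert_eq (F : Sunflower α) (W : Finset α) (e : α) (he : e ∉ W) :
    nested (insert e W) (fun X S T => s6H (F.lab X) (F.lab S) (F.lab T))
      = 3 * nested W (fun X S T => s6H (F.lab (insert e X)) (F.lab S) (F.lab T)) := by
  -- split the outer and inner sums according to the block containing `e`
  have hsplit : nested (insert e W) (fun X S T => s6H (F.lab X) (F.lab S) (F.lab T))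
      = nested W (fun X S T => s6H (F.lab (insert e X)) (F.lab S) (F.lab T))
        + nested W (fun X S T => s6H (F.lab X) (F.lab (insert e S)) (F.lab T))
        + nested W (fun X S T => s6H (F.lab X) (F.lab S) (F.lab (insert e T))) := by
    unfold nested
    rw [sum_powerset_insert he]
    have hA : ∀ X ∈ W.powerset,
        (∑ S ∈ (insert e W \ X).powerset, s6H (F.lab X) (F.lab S) (F.lab ((insert e W \ X) \ S)))
          = (∑ S ∈ (W \ X).powerset, s6H (F.lab X) (F.lab S) (F.lab (insert e ((W \ X) \ S))))
            + ∑ S ∈ (W \ X).powerset, s6H (F.lab X) (F.lab (insert e S)) (F.lab ((W \ X) \ S)) := by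
      intro X hX
      have heX : e ∉ X := fun h => he (mem_powerset.1 hX h)
      have heWX : e ∉ W \ X := fun h => he (mem_sdiff.1 h).1
      rw [insert_sdiff_of_notMem W heX, sum_powerset_insert heWX]
      congr 1
      · refine sum_congr rfl fun S hS => ?_
        have heS : e ∉ S := fun h => heWX (mem_powerset.1 hS h)
        rw [insert_sdiff_of_notMem (W \ X) heS]
      · refine sum_congr rfl fun S hS => ?_
        rw [insert_sdiff_insert_of_not_mem heWX]
    have hB : ∀ X ∈ W.powerset,
        (∑ S ∈ (insert e W \ insert e X).powerset, s6H (F.lab (insert e X)) (F.lab S) (F.lab ((insert e W \ insert e X) \ S)))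
          = ∑ S ∈ (W \ X).powerset, s6H (F.lab (insert e X)) (F.lab S) (F.lab ((W \ X) \ S)) := by
      intro X _
      rw [insert_sdiff_insert_of_not_mem he]
    rw [sum_congr rfl hA, sum_congr rfl hB, sum_add_distrib]
    ring
  -- the three placements are equal by block symmetry
  have h2 : nested W (fun X S T => s6H (F.lab X) (F.lab (insert e S)) (F.lab T))
      = nested W (fun X S T => s6H (F.lab (insert e X)) (F.lab S) (F.lab T)) := by
    rw [nested_swap12 W (fun X S T => s6H (F.lab X) (F.lab (insert e S)) (F.lab T))]
    unfold nested
    refine sum_congr rfl fun X _ => sum_congr rfl fun S _ => ?_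
    exact (s6H_symm _ _ _).1
  have h3 : nested W (fun X S T => s6H (F.lab X) (F.lab S) (F.lab (insert e T)))
      = nested W (fun X S T => s6H (F.lab (insert e X)) (F.lab S) (F.lab T)) := by
    rw [nested_swap23 W (fun X S T => s6H (F.lab X) (F.lab S) (F.lab (insert e T))),
      nested_swap12 W (fun X S T => s6H (F.lab X) (F.lab T) (F.lab (insert e S)))]
    unfold nested
    refine sum_congr rfl fun X _ => sum_congr rfl fun S _ => ?_
    exact s6H_cycle _ _ _
  rw [hsplit, h2, h3]
  ring

/-! ## (MZ) at a coordinate whose singleton is not a bottom set -/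

/-- **Restriction monotonicity at a non-bottom singleton** (this work): if `lab {e} ≠ 0` and `e ∉ W`, the nested partition sum does not
decrease when the free coordinate `e` is added to the sub-cube `W`. -/
theorem Sunflower.nested_le_nested_insert_of_lab_singleton_ne_zero (F : Sunflower α) (W : Finset α) (e : α) (he : e ∉ W)
    (hv : F.lab {e} ≠ 0) :
    nested W (fun X S T => s6H (F.lab X) (F.lab S) (F.lab T))
      ≤ nested (insert e W) (fun X S T => s6H (F.lab X) (F.lab S) (F.lab T)) := by
  rw [F.nested_insert_eq W e he]
  refine le_trans (F.three_joinLift_ge W (F.lab {e}) hv) ?_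
  refine mul_le_mul_of_nonneg_left ?_ (by norm_num)
  unfold nested
  refine sum_le_sum fun X _ => ?_
  dsimp only
  rcases F.lab_insert_cases e X hv with h | ⟨h4, hp⟩
  · rw [h]
  · rw [h4, ← sub_nonneg, ← sum_sub_distrib]
    exact F.promotion_sum_nonneg _ hp (W \ X)

/-- The nested partition sum is prove-1's `ZP W ∅ ∅ ∅`. [this work] -/
theorem Sunflower.ZP_empty_eq_nested (F : Sunflower α) (W : Finset α) :
    F.ZP W ∅ ∅ ∅ = nested W (fun X S T => s6H (F.lab X) (F.lab S) (F.lab T)) := by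
  rw [nested_eq_sum_filter]
  unfold Sunflower.ZP partsOf
  refine sum_congr rfl fun q _ => ?_
  rw [empty_union, empty_union, empty_union]

/-- **`RestrictionMonotonicity` holds at every coordinate whose singleton is a petal or kernel set** (this work):
`lab {e} ≠ 0`, `e ∉ W` ⟹ `F.ZP W ∅ ∅ ∅ ≤ F.ZP (insert e W) ∅ ∅ ∅`.  (Proof: expansion `nested_insert_eq`; `lab (insert e X) ∈ {lab{e} ∨ lab X, ⊤}`
and `Sunflower.promotion_sum_nonneg` where it is `⊤`; the principal-lift inequality `three_joinLift_ge` = three spectator Gladkov inequalities.) -/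
theorem Sunflower.ZP_le_ZP_insert_of_lab_singleton_ne_zero (F : Sunflower α) (W : Finset α) (e : α) (he : e ∉ W)
    (hv : F.lab {e} ≠ 0) : F.ZP W ∅ ∅ ∅ ≤ F.ZP (insert e W) ∅ ∅ ∅ := by
  rw [F.ZP_empty_eq_nested, F.ZP_empty_eq_nested]
  exact F.nested_le_nested_insert_of_lab_singleton_ne_zero W e he hv

/-- **Corollary** (this work): the partition lemma `0 ≤ ZP W ∅ ∅ ∅` holds on every sub-cube all of whose singletons are petal or kernel
sets (induct on `W` from `ZP ∅ ∅ ∅ ∅ = 0`). -/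
theorem Sunflower.ZP_nonneg_of_forall_lab_singleton_ne_zero (F : Sunflower α) (W : Finset α)
    (hW : ∀ e ∈ W, F.lab {e} ≠ 0) : 0 ≤ F.ZP W ∅ ∅ ∅ := by
  induction W using Finset.induction_on with
  | empty => rw [F.ZP_empty]
  | insert e W' he ih =>
    have h1 : 0 ≤ F.ZP W' ∅ ∅ ∅ := ih fun x hx => hW x (mem_insert_of_mem hx)
    exact le_trans h1 (F.ZP_le_ZP_insert_of_lab_singleton_ne_zero W' e he (hW e (mem_insert_self e W')))

/-- Whole-type form: if every singleton is a petal or kernel set then `0 ≤ ZH` (the partition lemma for this sunflower). [this work] -/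
theorem Sunflower.ZH_nonneg_of_forall_lab_singleton_ne_zero {β : Type*} [Fintype β] [DecidableEq β] (F : Sunflower β)
    (h : ∀ e : β, F.lab {e} ≠ 0) : 0 ≤ F.ZH := by
  rw [← F.ZP_univ_empty]
  exact F.ZP_nonneg_of_forall_lab_singleton_ne_zero univ fun e _ => h e

end Summit.CriticalPhenomena.PercolationContinuityZ3.Theorems.SunflowerPartition
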